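import Literature.Analysis.FluidPDE.LerayHopfTimeSliceTorus

/-!
# AnomalousDissipation / ImpulseGrid — tools for the support item `KickLemma`

Route `AnomalousDissipation/ImpulseGrid`, item stmt-AnomalousDissipation-1775 (`KickLemma`, support;
NOT in the assembly). This file carries the self-contained helper lemmas of the proof (landed
`--supports`; the item itself is closed by `ImpulseGridKickLemma.lean`):

* the primitive `Φ(τ) = ∫₀^τ φ` of a smooth kick profile `φ ≥ 0` supported in `(0, δ)` with
  `∫₀^δ φ = 1` (smooth, `Φ' = φ`, `Φ = 0` on `(−∞,0]`, `Φ = 1` on `[δ,∞)`, `0 ≤ Φ ≤ 1`) and the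
  **free half-kick** `∫₀^δ (1 − Φ) φ = ½` (the deterministic twin of Itô's `½ Tr Q` in the
  random-kick energy balance, Kuksin–Shirikyan 2012, §2);
* the periodic kick train `f(t,x) = φ(T·fract(t/T)) g(x)`: `T·fract(s/T) = s − nT` on the `n`-th
  period, space–time measurability of its lift, finiteness of `∫₀^{T₁}∫ ‖f‖²`;
* the slice bound `|(U,(U·∇)g) + ν(U,Δg)| ≤ (2D + K_L)(1 + E)` for `½‖U‖₂² ≤ E`, `0 < ν ≤ 1`;
* the **real-variable bookkeeping of one kick**: from the tested weak formulation
  `∫ (−φ(s−a)U + (1−Φ(s−a))F) + U₀ = 0`, the time-sliced identity `U(a) = U₀ + ∫_{(0,a]} F` and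
  `|F − φ(·−a)G| ≤ K'` on `(a, a+δ)` one gets `|∫ₐ^{a+δ} φ(s−a)U(s) ds − ½G − U(a)| ≤ K'δ`.

Everything here is folklore real analysis / bookkeeping; the Navier–Stokes input enters only in
`ImpulseGridKickLemma.lean`.
-/

noncomputable section

-- `Summit.<Summit>.<Problem>` is the tree's mandated summit-side namespace (CONVENTIONS §2); for this
-- single-conjunct summit the two coincide, so the duplicate is deliberate.
set_option linter.dupNamespace false

open MeasureTheory TopologicalSpace Set Function Filter Topology
open scoped InnerProductSpace RealInnerProductSpace ENNReal NNReal ContDiff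

namespace Summit.AnomalousDissipation.AnomalousDissipation.Theorems

open Literature.Analysis Literature.Analysis.FluidPDE Literature.Analysis.FunctionSpaces

/-! ### The primitive `Φ(τ) = ∫₀^τ φ` of the kick profile -/

/-- FTC-1 for the primitive of a continuous profile: `Φ' = φ`. [folklore] -/
theorem kick_prim_hasDerivAt {φ : ℝ → ℝ} (hφ : Continuous φ) (τ : ℝ) :
    HasDerivAt (fun τ => ∫ s in (0:ℝ)..τ, φ s) (φ τ) τ :=
  (hφ.integral_hasStrictDerivAt 0 τ).hasDerivAt

/-- The primitive of a smooth profile is smooth. [folklore] -/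
theorem kick_prim_contDiff {φ : ℝ → ℝ} (hφ : ContDiff ℝ ∞ φ) :
    ContDiff ℝ ∞ (fun τ => ∫ s in (0:ℝ)..τ, φ s) := by
  have hd : deriv (fun τ => ∫ s in (0:ℝ)..τ, φ s) = φ :=
    funext fun τ => (kick_prim_hasDerivAt hφ.continuous τ).deriv
  rw [contDiff_infty_iff_deriv, hd]
  exact ⟨fun τ => (kick_prim_hasDerivAt hφ.continuous τ).differentiableAt, hφ⟩

/-- A profile supported in `(0, δ)` vanishes off `(0, δ)`. [folklore] -/
theorem kick_eq_zero_of_not_mem {φ : ℝ → ℝ} {δ : ℝ} (hsupp : ∀ s, φ s ≠ 0 → s ∈ Ioo 0 δ)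
    {s : ℝ} (hs : s ∉ Ioo 0 δ) : φ s = 0 := by
  by_contra h
  exact hs (hsupp s h)

/-- `Φ(τ) = 0` for `τ ≤ 0` when `φ` is supported in `(0, δ)`. [folklore] -/
theorem kick_prim_eq_zero {φ : ℝ → ℝ} {δ : ℝ} (hsupp : ∀ s, φ s ≠ 0 → s ∈ Ioo 0 δ)
    {τ : ℝ} (hτ : τ ≤ 0) : ∫ s in (0:ℝ)..τ, φ s = 0 := by
  rw [intervalIntegral.integral_congr (g := fun _ => (0:ℝ)) ?_, intervalIntegral.integral_zero]
  intro s hs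
  rw [uIcc_of_ge hτ] at hs
  exact kick_eq_zero_of_not_mem hsupp fun h => h.1.not_ge hs.2

/-- `Φ(τ) = 1` for `τ ≥ δ` when `φ` is supported in `(0, δ)` and `∫₀^δ φ = 1`. [folklore] -/
theorem kick_prim_eq_one {φ : ℝ → ℝ} {δ : ℝ} (hφ : Continuous φ)
    (hsupp : ∀ s, φ s ≠ 0 → s ∈ Ioo 0 δ) (hint : ∫ s in (0:ℝ)..δ, φ s = 1)
    {τ : ℝ} (hτ : δ ≤ τ) : ∫ s in (0:ℝ)..τ, φ s = 1 := by
  rw [← intervalIntegral.integral_add_adjacent_intervals (b := δ) (hφ.intervalIntegrable _ _)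
    (hφ.intervalIntegrable _ _), hint]
  have h0 : ∫ s in δ..τ, φ s = 0 := by
    rw [intervalIntegral.integral_congr (g := fun _ => (0:ℝ)) ?_, intervalIntegral.integral_zero]
    intro s hs
    rw [uIcc_of_le hτ] at hs
    exact kick_eq_zero_of_not_mem hsupp fun h => h.2.not_ge hs.1
  rw [h0, add_zero]

/-- `0 ≤ Φ` for a nonnegative profile supported in `(0, δ)`. [folklore] -/
theorem kick_prim_nonneg {φ : ℝ → ℝ} {δ : ℝ} (hsupp : ∀ s, φ s ≠ 0 → s ∈ Ioo 0 δ)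
    (hnn : ∀ s, 0 ≤ φ s) (τ : ℝ) : 0 ≤ ∫ s in (0:ℝ)..τ, φ s := by
  rcases le_total 0 τ with hτ | hτ
  · exact intervalIntegral.integral_nonneg hτ fun s _ => hnn s
  · rw [kick_prim_eq_zero hsupp hτ]

/-- `Φ ≤ 1` for a nonnegative profile supported in `(0, δ)` with `∫₀^δ φ = 1`. [folklore] -/
theorem kick_prim_le_one {φ : ℝ → ℝ} {δ : ℝ} (hφ : Continuous φ)
    (hsupp : ∀ s, φ s ≠ 0 → s ∈ Ioo 0 δ) (hnn : ∀ s, 0 ≤ φ s) (hint : ∫ s in (0:ℝ)..δ, φ s = 1)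
    (τ : ℝ) : ∫ s in (0:ℝ)..τ, φ s ≤ 1 := by
  rcases le_total τ δ with hτ | hτ
  · have h := intervalIntegral.integral_add_adjacent_intervals (μ := volume) (a := 0) (b := τ)
      (c := δ) (hφ.intervalIntegrable _ _) (hφ.intervalIntegrable _ _)
    have h2 : 0 ≤ ∫ s in τ..δ, φ s := intervalIntegral.integral_nonneg hτ fun s _ => hnn s
    linarith
  · rw [kick_prim_eq_one hφ hsupp hint hτ]

/-- **The free half-kick.** `∫₀^δ (1 − Φ) φ = ½` whenever `Φ' = φ`, `Φ(0) = 0`, `Φ(δ) = 1`: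
`d/dτ (Φ − Φ²/2) = (1 − Φ) φ` (the deterministic twin of Itô's `½ Tr Q`, Kuksin–Shirikyan 2012,
§2). [folklore] -/
theorem kick_integral_one_sub_prim_mul {φ Φ : ℝ → ℝ} {δ : ℝ} (hφ : Continuous φ)
    (hΦd : ∀ τ, HasDerivAt Φ (φ τ) τ) (h0 : Φ 0 = 0) (h1 : Φ δ = 1) :
    ∫ τ in (0:ℝ)..δ, (1 - Φ τ) * φ τ = 2⁻¹ := by
  have hderiv : ∀ τ ∈ uIcc 0 δ,
      HasDerivAt (fun τ => Φ τ - Φ τ * Φ τ / 2) ((1 - Φ τ) * φ τ) τ := by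
    intro τ _
    have h3 : HasDerivAt (fun τ => Φ τ - Φ τ * Φ τ / 2)
        (φ τ - (φ τ * Φ τ + Φ τ * φ τ) / 2) τ :=
      (hΦd τ).sub (((hΦd τ).mul (hΦd τ)).div_const 2)
    convert h3 using 1
    ring
  have hΦc : Continuous Φ := continuous_iff_continuousAt.2 fun τ => (hΦd τ).continuousAt
  have hcont : Continuous fun τ => (1 - Φ τ) * φ τ := (continuous_const.sub hΦc).mul hφ
  rw [intervalIntegral.integral_eq_sub_of_hasDerivAt hderiv (hcont.intervalIntegrable _ _), h0, h1]
  norm_num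

/-- A continuous profile supported in `(0, δ)` is bounded: `|φ| ≤ M`. [folklore] -/
theorem kick_exists_bound {φ : ℝ → ℝ} {δ : ℝ} (hφ : Continuous φ)
    (hsupp : ∀ s, φ s ≠ 0 → s ∈ Ioo 0 δ) : ∃ M : ℝ, 0 ≤ M ∧ ∀ s, |φ s| ≤ M := by
  obtain ⟨C, hC⟩ := isCompact_Icc.exists_bound_of_continuousOn (hφ.continuousOn (s := Icc 0 δ))
  refine ⟨max C 0, le_max_right _ _, fun s => ?_⟩
  by_cases hs : φ s = 0
  · rw [hs, abs_zero]; exact le_max_right _ _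
  · have := hC s (Ioo_subset_Icc_self (hsupp s hs))
    rw [Real.norm_eq_abs] at this
    exact this.trans (le_max_left _ _)

/-! ### The periodic kick train `f(t, x) = φ(T · fract(t/T)) g(x)` -/

/-- On the `n`-th period, `T · fract(s/T) = s − nT`. [folklore] -/
theorem kickTrain_mul_fract_div_eq_sub {T s : ℝ} {n : ℕ} (hT : 0 < T) (h1 : (n:ℝ) * T ≤ s)
    (h2 : s < ((n:ℝ) + 1) * T) : T * Int.fract (s / T) = s - n * T := by
  have hfloor : ⌊s / T⌋ = (n : ℤ) := by
    rw [Int.floor_eq_iff, Int.cast_natCast, le_div_iff₀ hT, div_lt_iff₀ hT]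
    exact ⟨h1, h2⟩
  rw [← Int.self_sub_floor, hfloor, Int.cast_natCast, mul_sub, mul_div_cancel₀ _ hT.ne']
  ring

/-- The space–time lift of the kick train is (a.e. strongly) measurable. [folklore] -/
theorem aestronglyMeasurable_stLift_kickTrain {φ : ℝ → ℝ} (hφ : Continuous φ) (T : ℝ)
    {g : UnitAddTorus (Fin 3) → EuclideanSpace ℝ (Fin 3)} (hg : Torus.IsSmooth g)
    (μ : Measure (ℝ × EuclideanSpace ℝ (Fin 3))) :
    AEStronglyMeasurable (Torus.stLift (fun t x => φ (T * Int.fract (t / T)) • g x)) μ := by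
  have h1 : Measurable fun p : ℝ × EuclideanSpace ℝ (Fin 3) => φ (T * Int.fract (p.1 / T)) :=
    hφ.measurable.comp (measurable_const.mul (measurable_fract.comp (measurable_fst.div_const T)))
  have h2 : Continuous fun p : ℝ × EuclideanSpace ℝ (Fin 3) => g (Torus.proj p.2) :=
    hg.continuous.comp (Torus.continuous_proj.comp continuous_snd)
  exact h1.aestronglyMeasurable.smul h2.aestronglyMeasurable

/-- The kick train is space–time square integrable on every strip `(0, T₁) × T³`. [folklore] -/
theorem lintegral_kickTrain_lt_top {φ : ℝ → ℝ} {δ : ℝ} (hφ : Continuous φ)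
    (hsupp : ∀ s, φ s ≠ 0 → s ∈ Ioo 0 δ) (T T₁ : ℝ)
    {g : UnitAddTorus (Fin 3) → EuclideanSpace ℝ (Fin 3)} (hg : Torus.IsSmooth g) :
    ∫⁻ t in Ioo 0 T₁, ∫⁻ x, ‖φ (T * Int.fract (t / T)) • g x‖ₑ ^ 2 < ⊤ := by
  obtain ⟨M, hM0, hM⟩ := kick_exists_bound hφ hsupp
  obtain ⟨Kg, hKg0, hKg⟩ := Torus.exists_nonneg_forall_norm_le_of_continuous hg.continuous
  have hb : ∀ t x, ‖φ (T * Int.fract (t / T)) • g x‖ₑ ^ 2 ≤ ENNReal.ofReal ((M * Kg) ^ 2) := by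
    intro t x
    rw [← ofReal_norm, ← ENNReal.ofReal_pow (norm_nonneg _)]
    refine ENNReal.ofReal_le_ofReal (pow_le_pow_left₀ (norm_nonneg _) ?_ 2)
    rw [norm_smul, Real.norm_eq_abs]
    exact mul_le_mul (hM _) (hKg _) (norm_nonneg _) hM0
  calc ∫⁻ t in Ioo 0 T₁, ∫⁻ x, ‖φ (T * Int.fract (t / T)) • g x‖ₑ ^ 2
      ≤ ∫⁻ _ in Ioo 0 T₁, ∫⁻ _ : UnitAddTorus (Fin 3), ENNReal.ofReal ((M * Kg) ^ 2) :=
        lintegral_mono fun t => lintegral_mono fun x => hb t x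
    _ < ⊤ := by
        rw [lintegral_const, lintegral_const, Measure.restrict_apply_univ]
        exact ENNReal.mul_lt_top (ENNReal.mul_lt_top ENNReal.ofReal_lt_top (measure_lt_top _ _))
          measure_Ioo_lt_top

/-! ### The slice bound on the non-forcing part of the flux -/

/-- For an `L²` slice `U` with `½∫‖U‖² ≤ E` and `0 < ν ≤ 1`:
`|∫⟪U,(U·∇)g⟫ + ν ∫⟪U,Δg⟫| ≤ (2D + K_L)(1 + E)` when `∑ᵢ‖∂ᵢg‖ ≤ D` and `‖Δg‖ ≤ K_L`. [folklore] -/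
theorem kick_abs_flux_core_le {U g : UnitAddTorus (Fin 3) → EuclideanSpace ℝ (Fin 3)}
    (hU : MemLp U 2 volume) (hg : Torus.IsSmooth g) {D KL E ν : ℝ}
    (hD : ∀ x, ∑ i, ‖Torus.partialDeriv i g x‖ ≤ D) (hKL0 : 0 ≤ KL)
    (hKL : ∀ x, ‖Torus.laplacian g x‖ ≤ KL) (hν : 0 < ν) (hν1 : ν ≤ 1)
    (hE : Torus.kineticEnergy U ≤ E) :
    |(∫ x, ⟪U x, Torus.convect U g x⟫) + ν * ∫ x, ⟪U x, Torus.laplacian g x⟫| ≤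
      (2 * D + KL) * (1 + E) := by
  have hE0 : 0 ≤ E := (Torus.kineticEnergy_nonneg U).trans hE
  have hsq : ∫ x, ‖U x‖ ^ 2 ≤ 2 * E := by
    have : 2⁻¹ * ∫ x, ‖U x‖ ^ 2 ≤ E := hE
    linarith
  have hD0 : 0 ≤ D := le_trans (Finset.sum_nonneg fun i _ => norm_nonneg _) (hD 0)
  have b1 : |∫ x, ⟪U x, Torus.convect U g x⟫| ≤ D * (2 * E) :=
    (Torus.abs_integral_inner_convect_self_le hU hg hD).trans (by gcongr)
  have b2 : |ν * ∫ x, ⟪U x, Torus.laplacian g x⟫| ≤ KL * (1 + E) := by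
    rw [abs_mul, abs_of_pos hν]
    have h1 : |∫ x, ⟪U x, Torus.laplacian g x⟫| ≤ KL * (2⁻¹ * (1 + 2 * E)) := by
      refine (Torus.abs_integral_inner_le_of_norm_le (hU.integrable one_le_two) hKL).trans ?_
      refine mul_le_mul_of_nonneg_left ((Torus.integral_norm_le_of_memLp_two hU).trans ?_) hKL0
      gcongr
    have h2 : KL * (2⁻¹ * (1 + 2 * E)) ≤ KL * (1 + E) :=
      mul_le_mul_of_nonneg_left (by linarith) hKL0
    calc ν * |∫ x, ⟪U x, Torus.laplacian g x⟫| ≤ 1 * |∫ x, ⟪U x, Torus.laplacian g x⟫| := by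
          gcongr
      _ ≤ KL * (1 + E) := by rw [one_mul]; exact h1.trans h2
  calc |(∫ x, ⟪U x, Torus.convect U g x⟫) + ν * ∫ x, ⟪U x, Torus.laplacian g x⟫|
      ≤ |∫ x, ⟪U x, Torus.convect U g x⟫| + |ν * ∫ x, ⟪U x, Torus.laplacian g x⟫| :=
        abs_add_le _ _
    _ ≤ D * (2 * E) + KL * (1 + E) := add_le_add b1 b2
    _ ≤ (2 * D + KL) * (1 + E) := by nlinarith

/-! ### Real-variable bookkeeping of one kick -/

/-- **Bookkeeping of one kick** (pure real analysis). Let `U, F` be integrable on `(0, T₁)`,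
`0 < a`, `a + δ < T₁`, `φ` a continuous profile supported in `(0, δ)`, `Φ` continuous with
`Φ = 0` on `(−∞, 0]`, `Φ = 1` on `[δ, ∞)`, `0 ≤ Φ ≤ 1`, `∫₀^δ (1 − Φ)φ = ½`. If
`∫_{(0,T₁)} (−φ(s−a) U(s) + (1 − Φ(s−a)) F(s)) ds + U₀ = 0` (the tested weak formulation),
`U(a) = U₀ + ∫_{(0,a]} F` (the time-sliced identity) and `|F(s) − φ(s−a) G| ≤ K'` on
`(a, a+δ)`, then `|∫ₐ^{a+δ} φ(s−a) U(s) ds − ½ G − U(a)| ≤ K' δ`. [folklore] -/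
theorem kick_bookkeeping {U F φ Φ : ℝ → ℝ} {a δ T₁ G Ua U₀ K' : ℝ}
    (ha : 0 < a) (hδ : 0 < δ) (haδ : a + δ < T₁) (hφc : Continuous φ) (hΦc : Continuous Φ)
    (hsupp : ∀ s, φ s ≠ 0 → s ∈ Ioo 0 δ)
    (hΦ0 : ∀ τ, τ ≤ 0 → Φ τ = 0) (hΦ1 : ∀ τ, δ ≤ τ → Φ τ = 1)
    (hΦnn : ∀ τ, 0 ≤ Φ τ) (hΦle : ∀ τ, Φ τ ≤ 1)
    (hhalf : ∫ τ in (0:ℝ)..δ, (1 - Φ τ) * φ τ = 2⁻¹)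
    (hUint : IntegrableOn U (Ioo 0 T₁)) (hFint : IntegrableOn F (Ioo 0 T₁))
    (htest : (∫ s in Ioo 0 T₁, (-φ (s - a) * U s + (1 - Φ (s - a)) * F s)) + U₀ = 0)
    (hslice : Ua = U₀ + ∫ s in Ioc 0 a, F s)
    (hcore : ∀ s ∈ Ioo a (a + δ), |F s - φ (s - a) * G| ≤ K') :
    |(∫ s in a..(a + δ), φ (s - a) * U s) - 2⁻¹ * G - Ua| ≤ K' * δ := by
  have haT₁ : a < T₁ := by linarith
  obtain ⟨M, -, hM⟩ := kick_exists_bound hφc hsupp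
  have hφ0 : ∀ s, s ∉ Ioo 0 δ → φ s = 0 := fun s hs => kick_eq_zero_of_not_mem hsupp hs
  have habsΦ : ∀ τ, |1 - Φ τ| ≤ 1 := fun τ =>
    abs_le.2 ⟨by linarith [hΦle τ], by linarith [hΦnn τ]⟩
  -- integrability of the two products on `(0, T₁)`
  have hI1 : IntegrableOn (fun s => -φ (s - a) * U s) (Ioo 0 T₁) := by
    refine Integrable.bdd_mul (c := M) hUint.integrable
      ((hφc.comp (continuous_id.sub continuous_const)).neg).aestronglyMeasurable
      (ae_of_all _ fun s => ?_)
    rw [Real.norm_eq_abs, abs_neg]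
    exact hM _
  have hI2 : IntegrableOn (fun s => (1 - Φ (s - a)) * F s) (Ioo 0 T₁) := by
    refine Integrable.bdd_mul (c := 1) hFint.integrable
      (continuous_const.sub (hΦc.comp (continuous_id.sub continuous_const))).aestronglyMeasurable
      (ae_of_all _ fun s => ?_)
    rw [Real.norm_eq_abs]
    exact habsΦ _
  -- (E1) split the tested identity
  have hE1 : ∫ s in Ioo 0 T₁, φ (s - a) * U s =
      U₀ + ∫ s in Ioo 0 T₁, (1 - Φ (s - a)) * F s := by
    rw [integral_add hI1 hI2] at htest
    have hneg : ∫ s in Ioo 0 T₁, -φ (s - a) * U s = -∫ s in Ioo 0 T₁, φ (s - a) * U s := by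
      rw [← integral_neg]
      refine integral_congr_ae (ae_of_all _ fun s => ?_)
      ring
    rw [hneg] at htest
    linarith
  -- (E2) the work integral lives on `(a, a + δ)`
  have hE2 : ∫ s in Ioo 0 T₁, φ (s - a) * U s = ∫ s in Ioo a (a + δ), φ (s - a) * U s := by
    refine setIntegral_eq_of_subset_of_forall_sdiff_eq_zero measurableSet_Ioo
      (Ioo_subset_Ioo ha.le haδ.le) fun s hs => ?_
    have : φ (s - a) = 0 :=
      hφ0 _ fun h => hs.2 ⟨by linarith [h.1], by linarith [h.2]⟩
    rw [this, zero_mul]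
  -- (E3) the flux integral splits at `a` and lives on `(0, a] ∪ (a, a + δ)`
  have hE3 : ∫ s in Ioo 0 T₁, (1 - Φ (s - a)) * F s =
      (∫ s in Ioc 0 a, F s) + ∫ s in Ioo a (a + δ), (1 - Φ (s - a)) * F s := by
    have hdisj : Disjoint (Ioc 0 a) (Ioo a T₁) :=
      Set.disjoint_left.2 fun s hs hs' => lt_irrefl a (hs'.1.trans_le hs.2)
    rw [← Ioc_union_Ioo_eq_Ioo ha.le haT₁, setIntegral_union hdisj measurableSet_Ioo
      (hI2.mono_set fun s hs => ⟨hs.1, hs.2.trans_lt haT₁⟩)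
      (hI2.mono_set (Ioo_subset_Ioo_left ha.le))]
    congr 1
    · refine setIntegral_congr_fun measurableSet_Ioc fun s hs => ?_
      rw [hΦ0 _ (by linarith [hs.2]), sub_zero, one_mul]
    · refine setIntegral_eq_of_subset_of_forall_sdiff_eq_zero measurableSet_Ioo
        (Ioo_subset_Ioo_right haδ.le) fun s hs => ?_
      have h1 : a + δ ≤ s := by
        by_contra h
        exact hs.2 ⟨hs.1.1, not_le.1 h⟩
      rw [hΦ1 _ (by linarith), sub_self, zero_mul]
  -- (E4) the free half-kick: `∫_{(a,a+δ)} (1 − Φ(s−a)) φ(s−a) = ½`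
  have hE4 : ∫ s in Ioo a (a + δ), (1 - Φ (s - a)) * φ (s - a) = 2⁻¹ := by
    rw [← integral_Ioc_eq_integral_Ioo, ← intervalIntegral.integral_of_le (by linarith),
      show (∫ s in a..(a + δ), (1 - Φ (s - a)) * φ (s - a)) =
        ∫ s in a..(a + δ), (fun τ => (1 - Φ τ) * φ τ) (s - a) from rfl,
      intervalIntegral.integral_comp_sub_right (fun τ => (1 - Φ τ) * φ τ) a]
    simp only [sub_self, add_sub_cancel_left]
    exact hhalf
  -- (E5) the remainder
  have hcont : Continuous fun s => (1 - Φ (s - a)) * φ (s - a) :=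
    (continuous_const.sub (hΦc.comp (continuous_id.sub continuous_const))).mul
      (hφc.comp (continuous_id.sub continuous_const))
  have hI3 : IntegrableOn (fun s => (1 - Φ (s - a)) * φ (s - a) * G) (Ioo a (a + δ)) :=
    ((hcont.mul continuous_const).integrableOn_Icc).mono_set Ioo_subset_Icc_self
  have hI4 : IntegrableOn (fun s => (1 - Φ (s - a)) * F s) (Ioo a (a + δ)) :=
    hI2.mono_set (Ioo_subset_Ioo ha.le haδ.le)
  have hE5 : (∫ s in Ioo a (a + δ), (1 - Φ (s - a)) * F s) - 2⁻¹ * G =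
      ∫ s in Ioo a (a + δ), (1 - Φ (s - a)) * (F s - φ (s - a) * G) := by
    rw [← hE4, ← integral_mul_const, ← integral_sub hI4 hI3]
    refine integral_congr_ae (ae_of_all _ fun s => ?_)
    ring
  have hE6 : |∫ s in Ioo a (a + δ), (1 - Φ (s - a)) * (F s - φ (s - a) * G)| ≤ K' * δ := by
    have h := norm_setIntegral_le_of_norm_le_const (μ := volume) (s := Ioo a (a + δ))
      (f := fun s => (1 - Φ (s - a)) * (F s - φ (s - a) * G)) (C := K') measure_Ioo_lt_top
      fun s hs => by
        rw [Real.norm_eq_abs, abs_mul]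
        calc |1 - Φ (s - a)| * |F s - φ (s - a) * G| ≤ 1 * K' :=
              mul_le_mul (habsΦ _) (hcore s hs) (abs_nonneg _) zero_le_one
          _ = K' := one_mul _
    rwa [Real.norm_eq_abs, Real.volume_real_Ioo_of_le (by linarith), add_sub_cancel_left] at h
  -- assemble
  have hW : ∫ s in a..(a + δ), φ (s - a) * U s = ∫ s in Ioo a (a + δ), φ (s - a) * U s := by
    rw [intervalIntegral.integral_of_le (by linarith), integral_Ioc_eq_integral_Ioo]
  have hfinal : (∫ s in a..(a + δ), φ (s - a) * U s) - 2⁻¹ * G - Ua =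
      ∫ s in Ioo a (a + δ), (1 - Φ (s - a)) * (F s - φ (s - a) * G) := by
    rw [← hE5, hW, ← hE2, hE1, hE3, hslice]
    ring
  rw [hfinal]
  exact hE6

end Summit.AnomalousDissipation.AnomalousDissipation.Theorems

end
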